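import Summits.HodgeConjecture.HodgeConjecture.Theorems.F0P2aL2bHolLieSpanPackage
import Summits.HodgeConjecture.HodgeConjecture.Theorems.F0P2dStubT
import Literature.NumberTheory.Automorphic.AutomorphicFormsL2OrbitalSmoothing
import Literature.NumberTheory.Automorphic.AutomorphicRepsGLSatakeFlathProofs
import Literature.NumberTheory.Automorphic.ArchimedeanLieDerivKFinite
import Literature.Geometry.ComplexHyperbolic.UnitBallU21Borel
import HarnessLib

/-!
# Crux `H413`, (D) desk sub-line `F0_P2SpectralProjectionD`, STUB (S) — part 1 (generic): the `𝔭`-orbit map of the `L²` class of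
# a smooth automorphic function and the `L²` image of a reproducing kernel

HC_CM is proved only modulo the printed citations until rung 0 closes.  Cell `hodgecm-mathlib`, floor 0, programme P2, socket (D)
`CotangentForms.holCotFormSpectralProjection`, desk sub-line `Cruxes/H413/Lines/F0_P2SpectralProjectionD.lean` (F0P2-plan (g2), v1.1),
stub (S) `stub_S_cotFormL2Data`; this is the GENERIC half (any adelic group datum `𝒢`, any `ιinf : U(2,1) → G(𝔸_K)`), consumed by
`Theorems/F0P2dStubSCotFormL2Data.lean` (the CM assembly).  Everything is proved; no definition, no instance, no `sorry`.

* §1 `norm_sub_sub_lieDeriv_le` — the SECOND-ORDER mean-value bound along a one-parameter subgroup: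
  `‖φ(g exp X) − φ(g) − (Xφ)(g)‖ ≤ sup ‖X(Xφ)‖` (★ `IsArchSmooth.hasDerivAt_expMem_smul`, `norm_sub_le_of_lieDeriv_le`).
* §2 the four real `𝔭`-directions `e_i`, `i e_i` of `ℂ² ≅ 𝔭` (★ `BallForms.liePMat`): `X_b` is real-linear in `b` on smooth functions
  (★ `IsArchSmooth.lieDeriv_add_left` ∕ `lieDeriv_smul_left`), `‖X_b Ψ‖ ≤ 4 C ‖b‖`, `‖X_b X_b φ‖ ≤ 16 M ‖b‖²` (bilinear expansion, ★
  `IsArchSmooth.lieDeriv_finset_sum_smul`).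
* §3 `sum_integral_smul_rightRegular_toLp_eq_self` — pointwise reproduction `∫ A(u) Φ(y ιinf u) dν(u) = Φ(y)` by a continuous
  compactly supported matrix kernel implies `Σ_i ∫ A(u)_{ji} • R(ιinf u)[Φ·i] dν(u) = [Φ·j]` in `L²(μ)` (Fubini representative ★ p796993
  `coeFn_integral_smul_rightRegular_toLp_eq_orbitalIntegral`); `differentiableAt_rightRegular_expP_toLp` — for `φ` continuous,
  left-invariant, smooth in the archimedean variable, with continuous left-invariant first derivatives `X_{e_i} φ`, bounded second
  derivatives and Cauchy–Riemann `X_{i e_i} φ = i X_{e_i} φ`, the `𝔭`-orbit map `b ↦ R(ιinf expP b)[φ]` is Fréchet differentiable at `0`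
  with the `ℂ`-LINEAR derivative `b ↦ Σ_i b_i • [X_{e_i} φ]` (remainder = class of `φ(· expP b) − φ − X_b φ`, `O(‖b‖²)` in `L²` by §1–§2 and
  Mathlib `Lp.norm_le_of_ae_bound`), hence weak Cauchy–Riemann `D(ib) = i D(b)`.

## References

* [Borel1997] A. Borel, *Automorphic forms on SL₂(ℝ)*, Cambridge Tracts in Math. 130 (1997), §2.1 (4), §2.13–2.14, §5.14.
* [BorelJacquet1979] A. Borel, H. Jacquet, *Automorphic forms and automorphic representations*, PSPM 33.1 (1979), §1.5, §4.2, §4.6.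
* [BorelWallach2000] A. Borel, N. Wallach, *Continuous cohomology, discrete subgroups, and representations of reductive groups*,
  2nd ed. (2000), VII 2.10.
* [Folland1995] G. B. Folland, *A Course in Abstract Harmonic Analysis* (1995), §3.2 (the integrated representation).
-/

set_option autoImplicit false

-- the mandated namespace has the single-problem summit's repeated segment (`HodgeConjecture.HodgeConjecture`)
set_option linter.dupNamespace false

noncomputable section

namespace Summit.HodgeConjecture.HodgeConjecture.Cruxes.H413.F0P2dStubSOrbitMap

open MeasureTheory NumberField MulAction Filter Topology Asymptotics
open scoped Matrix ComplexOrder ENNReal NNReal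
open Literature.NumberTheory.Automorphic Literature.NumberTheory.Automorphic.UnitaryGroup
open Literature.NumberTheory.Automorphic.UnitaryGroup.CotangentForms
open Literature.AlgebraicGeometry.ShimuraVarieties Literature.AlgebraicGeometry.ShimuraVarieties.BallForms
open Literature.Geometry.ComplexHyperbolic.BallModel (U21 x₀)
open Summit.HodgeConjecture.HodgeConjecture.Cruxes.H413.SpectrumJunction
open Summit.HodgeConjecture.HodgeConjecture.Cruxes.H413.F0P2aL2bHolLieSpanPackage


/-! ## §1 One-parameter calculus: the second-order mean-value bound along `t ↦ g · ι(exp tX)` -/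

section OneParameter

variable {A : Type*} [NormedCommRing A] [NormedAlgebra ℝ A] [NormedAlgebra ℚ A] [CompleteSpace A]
  [StarRing A] {N : Type*} [Fintype N] [DecidableEq N] {H : RealMatrixGroup A N}
  {G : Type*} [Group G] (ι : H.carrier →* G)

/-- **Second-order mean-value bound along a one-parameter subgroup.**  If `φ` and `X φ` are smooth in the archimedean
variable and `‖X (X φ)‖ ≤ C` everywhere, then `‖φ (g exp X) − φ g − (X φ)(g)‖ ≤ C`: the function
`t ↦ φ(g exp tX) − t (Xφ)(g)` has derivative `(Xφ)(g exp tX) − (Xφ)(g)`, of norm `≤ C |t| ≤ C` on `[0,1]` by the first-order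
bound ★ `IsArchSmooth.norm_sub_le_of_lieDeriv_le`. [cite: BorelJacquet1979, §1.5] [cite: Borel1997, §2.1 (4)] -/
theorem norm_sub_sub_lieDeriv_le {φ : G → ℂ} (hφ : IsArchSmooth ι φ) (X : H.lie)
    (hψ : IsArchSmooth ι (lieDeriv ι X φ)) {C : ℝ} (hC : ∀ g, ‖lieDeriv ι X (lieDeriv ι X φ) g‖ ≤ C) (g : G) :
    ‖φ (g * ι (H.expMem X)) - φ g - lieDeriv ι X φ g‖ ≤ C := by
  have hC0 : 0 ≤ C := (norm_nonneg _).trans (hC g)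
  have hderiv : ∀ t ∈ Set.Icc (0 : ℝ) 1,
      HasDerivWithinAt (fun t : ℝ => φ (g * ι (H.expMem (t • X))) - t • lieDeriv ι X φ g)
        (lieDeriv ι X φ (g * ι (H.expMem (t • X))) - lieDeriv ι X φ g) (Set.Icc 0 1) t := by
    intro t _
    have h1 := hφ.hasDerivAt_expMem_smul ι X g t
    have h2 : HasDerivAt (fun t : ℝ => t • lieDeriv ι X φ g) (lieDeriv ι X φ g) t := by
      simpa using (hasDerivAt_id t).smul_const (lieDeriv ι X φ g)
    exact (h1.sub h2).hasDerivWithinAt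
  have hbound : ∀ t ∈ Set.Icc (0 : ℝ) 1,
      ‖lieDeriv ι X φ (g * ι (H.expMem (t • X))) - lieDeriv ι X φ g‖ ≤ C := by
    intro t ht
    refine (hψ.norm_sub_le_of_lieDeriv_le ι X hC g t).trans ?_
    have : |t| ≤ 1 := abs_le.2 ⟨by linarith [ht.1], ht.2⟩
    nlinarith
  have h := Convex.norm_image_sub_le_of_norm_hasDerivWithin_le hderiv hbound (convex_Icc 0 1)
    (Set.left_mem_Icc.2 zero_le_one) (Set.right_mem_Icc.2 zero_le_one)
  simp only [RealMatrixGroup.expMem_zero_smul, map_one, mul_one, one_smul] at h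
  simp only [zero_smul, sub_zero, norm_one, mul_one] at h
  -- `h : ‖φ (g exp X) - Xφ g - φ g‖ ≤ C`
  have e : φ (g * ι (H.expMem X)) - φ g - lieDeriv ι X φ g =
      φ (g * ι (H.expMem X)) - lieDeriv ι X φ g - φ g := by ring
  rw [e]
  exact h

end OneParameter

/-! ## §2 The four real `𝔭`-directions `e_i`, `i e_i` and linear bounds for `X_b`, `b ∈ ℂ² ≅ 𝔭` -/

section PDirections

variable {G : Type*} [Group G] (ι : u21Group.carrier →* G)

/-- Real-coordinate expansion of `b ∈ ℂ²`: `b = Σ_i (Re b_i) e_i + (Im b_i) (i e_i)`. [cite: Borel1997, §2.1 (4)] -/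
theorem eq_sum_re_smul_add_im_smul (b : Fin 2 → ℂ) :
    b = ∑ i : Fin 2, ((b i).re • (Pi.single i (1 : ℂ) : Fin 2 → ℂ) + (b i).im • (Pi.single i Complex.I : Fin 2 → ℂ)) := by
  funext j
  simp only [Finset.sum_apply, Pi.add_apply, Pi.smul_apply, Pi.single_apply, Fin.sum_univ_two]
  fin_cases j <;> simp

/-- **`X_b` is real-linear in `b` on smooth functions**: `(X_b Ψ)(g) = Σ_i Re(b_i) (X_{e_i} Ψ)(g) + Im(b_i) (X_{i e_i} Ψ)(g)` for `Ψ`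
smooth in the archimedean variable (★ `IsArchSmooth.lieDeriv_add_left` ∕ `lieDeriv_smul_left`, ★ `smul_liePMat`).
[cite: BorelJacquet1979, §1.5] -/
theorem lieDeriv_liePMat_eq_sum {Ψ : G → ℂ} (hΨ : IsArchSmooth (H := u21Group) ι Ψ) (b : Fin 2 → ℂ) (g : G) :
    lieDeriv (H := u21Group) ι (liePMat b) Ψ g =
      ∑ i : Fin 2, ((b i).re * lieDeriv (H := u21Group) ι (liePMat (Pi.single i 1)) Ψ g +
        (b i).im * lieDeriv (H := u21Group) ι (liePMat (Pi.single i Complex.I)) Ψ g) := by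
  have hlin : liePMat b = ∑ i : Fin 2, ((b i).re • liePMat (Pi.single i (1 : ℂ)) + (b i).im • liePMat (Pi.single i Complex.I)) := by
    simp only [smul_liePMat]
    have hadd : ∀ b b' : Fin 2 → ℂ, liePMat (b + b') = liePMat b + liePMat b' := fun b b' =>
      Subtype.ext (pMat_add b b')
    rw [Fin.sum_univ_two, ← hadd, ← hadd, ← hadd]
    congr 1
    have e := eq_sum_re_smul_add_im_smul b
    rw [Fin.sum_univ_two] at e
    simpa only [add_assoc] using e
  rw [hlin, Fin.sum_univ_two, hΨ.lieDeriv_add_left ι, hΨ.lieDeriv_add_left ι, hΨ.lieDeriv_add_left ι,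
    hΨ.lieDeriv_smul_left ι, hΨ.lieDeriv_smul_left ι, hΨ.lieDeriv_smul_left ι, hΨ.lieDeriv_smul_left ι, Fin.sum_univ_two]
  simp only [Pi.add_apply, Pi.smul_apply, Complex.real_smul]

/-- **Linear bound**: if the four directional derivatives `X_{e_i} Ψ`, `X_{i e_i} Ψ` are bounded by `C` at `g`, then
`‖(X_b Ψ)(g)‖ ≤ 4 C ‖b‖`. [cite: BorelJacquet1979, §1.5] -/
theorem norm_lieDeriv_liePMat_le {Ψ : G → ℂ} (hΨ : IsArchSmooth (H := u21Group) ι Ψ) {C : ℝ} (g : G)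
    (h1 : ∀ i : Fin 2, ‖lieDeriv (H := u21Group) ι (liePMat (Pi.single i 1)) Ψ g‖ ≤ C)
    (hI : ∀ i : Fin 2, ‖lieDeriv (H := u21Group) ι (liePMat (Pi.single i Complex.I)) Ψ g‖ ≤ C) (b : Fin 2 → ℂ) :
    ‖lieDeriv (H := u21Group) ι (liePMat b) Ψ g‖ ≤ 4 * C * ‖b‖ := by
  have hC0 : 0 ≤ C := (norm_nonneg _).trans (h1 0)
  rw [lieDeriv_liePMat_eq_sum ι hΨ b g]
  have hterm : ∀ i : Fin 2,
      ‖(b i).re * lieDeriv (H := u21Group) ι (liePMat (Pi.single i 1)) Ψ g +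
          (b i).im * lieDeriv (H := u21Group) ι (liePMat (Pi.single i Complex.I)) Ψ g‖ ≤ 2 * C * ‖b‖ := by
    intro i
    have hre : ‖((b i).re : ℂ)‖ ≤ ‖b‖ :=
      (by simpa using Complex.abs_re_le_norm (b i) : ‖((b i).re : ℂ)‖ ≤ ‖b i‖).trans (norm_le_pi_norm b i)
    have him : ‖((b i).im : ℂ)‖ ≤ ‖b‖ :=
      (by simpa using Complex.abs_im_le_norm (b i) : ‖((b i).im : ℂ)‖ ≤ ‖b i‖).trans (norm_le_pi_norm b i)
    refine (norm_add_le _ _).trans ?_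
    rw [norm_mul, norm_mul]
    have hb0 : 0 ≤ ‖b‖ := norm_nonneg b
    nlinarith [mul_le_mul hre (h1 i) (norm_nonneg _) hb0, mul_le_mul him (hI i) (norm_nonneg _) hb0]
  refine (norm_sum_le _ _).trans ?_
  rw [Fin.sum_univ_two]
  linarith [hterm 0, hterm 1]

/-- **Function-level expansion of `X_b φ`** in the four real directions (for `φ` smooth in the archimedean variable).
[cite: BorelJacquet1979, §1.5] -/
theorem lieDeriv_liePMat_eq_sum_fun {φ : G → ℂ} (hφ : IsArchSmooth (H := u21Group) ι φ) (b : Fin 2 → ℂ) :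
    lieDeriv (H := u21Group) ι (liePMat b) φ =
      ∑ i : Fin 2, ((b i).re : ℂ) • lieDeriv (H := u21Group) ι (liePMat (Pi.single i 1)) φ +
        ∑ i : Fin 2, ((b i).im : ℂ) • lieDeriv (H := u21Group) ι (liePMat (Pi.single i Complex.I)) φ := by
  funext g
  rw [lieDeriv_liePMat_eq_sum ι hφ b g]
  simp only [Pi.add_apply, Finset.sum_apply, Pi.smul_apply, smul_eq_mul, Finset.sum_add_distrib]

/-- **Second-order bound**: if the sixteen second derivatives `X_e X_{e'} φ`, `e, e'` among the four real directions
`d(i,0) = e_i`, `d(i,1) = i e_i` (written `Pi.single i (if s = 0 then 1 else i)`), are bounded by `M` everywhere, then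
`‖X_b (X_b φ)(g)‖ ≤ 16 M ‖b‖²` for every `b ∈ ℂ²` and `g`. [cite: BorelJacquet1979, §1.5] -/
theorem norm_lieDeriv_lieDeriv_liePMat_le {φ : G → ℂ} (hφ : IsArchSmooth (H := u21Group) ι φ) {M : ℝ}
    (hM : ∀ (q q' : Fin 2 × Fin 2) (g : G),
      ‖lieDeriv (H := u21Group) ι (liePMat (Pi.single q.1 (if q.2 = 0 then (1 : ℂ) else Complex.I)))
        (lieDeriv (H := u21Group) ι (liePMat (Pi.single q'.1 (if q'.2 = 0 then (1 : ℂ) else Complex.I))) φ) g‖ ≤ M)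
    (b : Fin 2 → ℂ) (g : G) :
    ‖lieDeriv (H := u21Group) ι (liePMat b) (lieDeriv (H := u21Group) ι (liePMat b) φ) g‖ ≤ 16 * M * ‖b‖ ^ 2 := by
  have hsm : ∀ e : Fin 2 → ℂ, IsArchSmooth (H := u21Group) ι (lieDeriv (H := u21Group) ι (liePMat e) φ) := fun e =>
    isArchSmooth_lieDeriv_of_isArchSmooth ι (liePMat e) hφ
  have hM0 : 0 ≤ M := (norm_nonneg _).trans (hM (0, 0) (0, 0) g)
  have hre : ∀ i : Fin 2, ‖((b i).re : ℂ)‖ ≤ ‖b‖ := fun i =>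
    (by simpa using Complex.abs_re_le_norm (b i) : ‖((b i).re : ℂ)‖ ≤ ‖b i‖).trans (norm_le_pi_norm b i)
  have him : ∀ i : Fin 2, ‖((b i).im : ℂ)‖ ≤ ‖b‖ := fun i =>
    (by simpa using Complex.abs_im_le_norm (b i) : ‖((b i).im : ℂ)‖ ≤ ‖b i‖).trans (norm_le_pi_norm b i)
  have hb0 : 0 ≤ ‖b‖ := norm_nonneg b
  -- first-order bound for the four directional derivatives of `Ψ := X_b φ`
  have hdir : ∀ q : Fin 2 × Fin 2,
      ‖lieDeriv (H := u21Group) ι (liePMat (Pi.single q.1 (if q.2 = 0 then (1 : ℂ) else Complex.I)))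
        (lieDeriv (H := u21Group) ι (liePMat b) φ) g‖ ≤ 4 * M * ‖b‖ := by
    intro q
    have hS1 : IsArchSmooth (H := u21Group) ι
        (∑ i : Fin 2, ((b i).re : ℂ) • lieDeriv (H := u21Group) ι (liePMat (Pi.single i 1)) φ) :=
      (archSmooth ι).sum_mem fun i _ => (hsm _).smul ι _
    have hS2 : IsArchSmooth (H := u21Group) ι
        (∑ i : Fin 2, ((b i).im : ℂ) • lieDeriv (H := u21Group) ι (liePMat (Pi.single i Complex.I)) φ) :=
      (archSmooth ι).sum_mem fun i _ => (hsm _).smul ι _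
    rw [lieDeriv_liePMat_eq_sum_fun ι hφ b, IsArchSmooth.lieDeriv_add ι _ hS1 hS2,
      IsArchSmooth.lieDeriv_finset_sum_smul ι _ _ _ (fun i => hsm _),
      IsArchSmooth.lieDeriv_finset_sum_smul ι _ _ _ (fun i => hsm _)]
    simp only [Pi.add_apply, Finset.sum_apply, Pi.smul_apply, smul_eq_mul]
    have ht1 : ∀ i : Fin 2, ‖((b i).re : ℂ) *
        lieDeriv (H := u21Group) ι (liePMat (Pi.single q.1 (if q.2 = 0 then (1 : ℂ) else Complex.I)))
          (lieDeriv (H := u21Group) ι (liePMat (Pi.single i 1)) φ) g‖ ≤ ‖b‖ * M := fun i => by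
      rw [norm_mul]
      exact mul_le_mul (hre i) (by simpa using hM q (i, 0) g) (norm_nonneg _) hb0
    have ht2 : ∀ i : Fin 2, ‖((b i).im : ℂ) *
        lieDeriv (H := u21Group) ι (liePMat (Pi.single q.1 (if q.2 = 0 then (1 : ℂ) else Complex.I)))
          (lieDeriv (H := u21Group) ι (liePMat (Pi.single i Complex.I)) φ) g‖ ≤ ‖b‖ * M := fun i => by
      rw [norm_mul]
      exact mul_le_mul (him i) (by simpa using hM q (i, 1) g) (norm_nonneg _) hb0
    refine (norm_add_le _ _).trans ?_
    have hs1 := (norm_sum_le _ _).trans (Finset.sum_le_sum fun i (_ : i ∈ Finset.univ) => ht1 i)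
    have hs2 := (norm_sum_le _ _).trans (Finset.sum_le_sum fun i (_ : i ∈ Finset.univ) => ht2 i)
    simp only [Finset.sum_const, Finset.card_univ, Fintype.card_fin, nsmul_eq_mul, Nat.cast_ofNat] at hs1 hs2
    linarith
  have h := norm_lieDeriv_liePMat_le ι (hsm b) g (C := 4 * M * ‖b‖) (fun i => by simpa using hdir (i, 0))
    (fun i => by simpa using hdir (i, 1)) b
  nlinarith [h, norm_nonneg b]

end PDirections

/-! ## §3 Generic `L²` dictionary on an automorphic quotient: reproduction and the `𝔭`-orbit map -/

section L2Generic

variable {K : Type} [Field K] [NumberField K] {𝒢 : AdelicGroupData.{0} K} {μ : Measure 𝒢.automorphicQuotient}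

/-- **Pointwise reproduction ⇒ `L²` reproduction.**  If the continuous compactly supported matrix kernel `A` on `U(2,1)`
reproduces the continuous left-invariant `Φ : G(𝔸) → ℂ²` along the continuous `ιinf` — `∫ A(u) Φ(y ιinf u) dν(u) = Φ(y)` for
all `y` — then `Σ_i ∫ A(u)_{ji} • R(ιinf u)[Φ·i] dν(u) = [Φ·j]` in `L²(μ)`: the Bochner integral is represented by the orbital
integral (★ p796993 `coeFn_integral_smul_rightRegular_toLp_eq_orbitalIntegral`, Fubini), which is `Φ(·)_j` pointwise.
[cite: BorelJacquet1979, §4.6] [cite: Folland1995, §3.2] [cite: Borel1997, §2.13] -/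
theorem sum_integral_smul_rightRegular_toLp_eq_self [𝒢.IsAutomorphicMeasure μ] (ν : Measure ↥U21) [ν.IsHaarMeasure]
    {ιA : ↥U21 →* 𝒢.Adelic} (hι : Continuous ιA) {A : ↥U21 → Matrix (Fin 2) (Fin 2) ℂ}
    (hAc : Continuous A) (hAs : HasCompactSupport A) {Φ : 𝒢.Adelic → (Fin 2 → ℂ)}
    (hΦ : ∀ γ ∈ 𝒢.quotientSubgroup, ∀ g, Φ (γ * g) = Φ g) (hc : Continuous Φ)
    (hmem : ∀ i : Fin 2, MemLp (toQuotFun 𝒢 fun x => Φ x i) 2 μ)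
    (hrep : ∀ y, ∫ u, A u *ᵥ Φ (y * ιA u) ∂ν = Φ y) (j : Fin 2) :
    (∑ i : Fin 2, ∫ u, A u j i • 𝒢.rightRegular μ (ιA u) ((hmem i).toLp (toQuotFun 𝒢 fun x => Φ x i)) ∂ν) =
      (hmem j).toLp (toQuotFun 𝒢 fun x => Φ x j) := by
  have hleft : ∀ i, ∀ γ ∈ 𝒢.quotientSubgroup, ∀ g, (fun x => Φ x i) (γ * g) = (fun x => Φ x i) g :=
    fun i γ hγ g => by simp only [hΦ γ hγ g]
  have hα : ∀ i, Continuous fun u => A u j i := fun i => hAc.matrix_elem j i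
  have hαs : ∀ i, HasCompactSupport fun u => A u j i := fun i =>
    hAs.comp_left (g := fun B : Matrix (Fin 2) (Fin 2) ℂ => B j i) rfl
  have hF : ∀ i, ∀ᵐ y ∂μ, ∀ g : 𝒢.Adelic, 𝒢.toAutomorphicQuotient g = y →
      ((∫ u, A u j i • 𝒢.rightRegular μ (ιA u) ((hmem i).toLp (toQuotFun 𝒢 fun x => Φ x i)) ∂ν : 𝒢.L2 μ) :
        𝒢.automorphicQuotient → ℂ) y = ∫ u, A u j i * Φ (g⁻¹ * ιA u) i ∂ν := by
    intro i
    filter_upwards [𝒢.coeFn_integral_smul_rightRegular_toLp_eq_orbitalIntegral μ ν hι (hα i) (hαs i) (hmem i)]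
      with y hy g hg
    rw [hy g hg, invQuot_toQuotFun (hleft i)]
  apply Lp.ext
  have hadd := Lp.coeFn_add
    (∫ u, A u j 0 • 𝒢.rightRegular μ (ιA u) ((hmem 0).toLp (toQuotFun 𝒢 fun x => Φ x 0)) ∂ν)
    (∫ u, A u j 1 • 𝒢.rightRegular μ (ιA u) ((hmem 1).toLp (toQuotFun 𝒢 fun x => Φ x 1)) ∂ν)
  rw [Fin.sum_univ_two]
  filter_upwards [hadd, hF 0, hF 1, (hmem j).coeFn_toLp] with y hy h0 h1 hj
  obtain ⟨g, hg⟩ := toAutomorphicQuotient_surjective y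
  rw [hy, Pi.add_apply, h0 g hg, h1 g hg, hj, ← hg, toQuotFun_mk (hleft j) g]
  -- the pointwise reproduction at `g⁻¹`, coordinate `j`
  have horb : Continuous fun u : ↥U21 => Φ (g⁻¹ * ιA u) := hc.comp (continuous_const.mul hι)
  have hint : ∀ i, Integrable (fun u => A u j i * Φ (g⁻¹ * ιA u) i) ν := fun i =>
    ((hα i).mul ((continuous_apply i).comp horb)).integrable_of_hasCompactSupport (hαs i).mul_right
  have hvec : Integrable (fun u => A u *ᵥ Φ (g⁻¹ * ιA u)) ν := by
    refine (hAc.matrix_mulVec horb).integrable_of_hasCompactSupport (hAs.mono fun u hu => ?_)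
    rw [Function.mem_support] at hu ⊢
    intro hA0
    apply hu
    rw [hA0, Matrix.zero_mulVec]
  have key : ∫ u, (A u *ᵥ Φ (g⁻¹ * ιA u)) j ∂ν = Φ g⁻¹ j := by
    have h := (ContinuousLinearMap.proj (R := ℂ) (φ := fun _ : Fin 2 => ℂ) j).integral_comp_comm hvec
    simp only [ContinuousLinearMap.proj_apply] at h
    rw [h, hrep]
  simp only [Matrix.mulVec, dotProduct, Fin.sum_univ_two] at key
  rw [integral_add (hint 0) (hint 1)] at key
  exact key

/-- **The `𝔭`-orbit map of the class of a smooth function: Fréchet derivative at `0` and weak Cauchy–Riemann.**  Let `φ` be a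
continuous left-`A_G G(K)`-invariant function on `G(𝔸_K)` with compact automorphic quotient, smooth in the archimedean variable
along `ιinf : U(2,1) → G(𝔸_K)`, whose four directional derivatives `X_{e_i} φ` are continuous and left-invariant, whose sixteen
second derivatives `X_e X_{e'} φ` are bounded, and which satisfies Cauchy–Riemann `X_{i e_i} φ = i X_{e_i} φ`.  Then
`b ↦ R(ιinf expP b)[φ]` is (Fréchet) differentiable at `0` with the `ℂ`-LINEAR derivative `b ↦ Σ_i b_i • [X_{e_i} φ]`: the remainder
`[φ(· expP b)] − [φ] − Σ b_i [X_{e_i} φ]` is the class of `x ↦ φ(x expP b) − φ(x) − (X_b φ)(x)`, bounded by `16 M ‖b‖²` pointwise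
(§1–§2), hence of `L²`-norm `O(‖b‖²) = o(‖b‖)` (Mathlib `Lp.norm_le_of_ae_bound`). [cite: Borel1997, §2.1 (4) and §5.14]
[cite: BorelWallach2000, VII 2.10] [cite: BorelJacquet1979, §4.6] -/
theorem differentiableAt_rightRegular_expP_toLp [𝒢.IsAutomorphicMeasure μ] [CompactSpace 𝒢.automorphicQuotient]
    {ιA : u21Group.carrier →* 𝒢.Adelic} {φ : 𝒢.Adelic → ℂ}
    (hΦ : ∀ γ ∈ 𝒢.quotientSubgroup, ∀ g, φ (γ * g) = φ g) (hc : Continuous φ)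
    (hsm : IsArchSmooth (H := u21Group) ιA φ)
    (hD : ∀ i : Fin 2, Continuous (lieDeriv (H := u21Group) ιA (liePMat (Pi.single i 1)) φ) ∧
      ∀ γ ∈ 𝒢.quotientSubgroup, ∀ g, lieDeriv (H := u21Group) ιA (liePMat (Pi.single i 1)) φ (γ * g) =
        lieDeriv (H := u21Group) ιA (liePMat (Pi.single i 1)) φ g)
    (hCR : ∀ i : Fin 2, lieDeriv (H := u21Group) ιA (liePMat (Pi.single i Complex.I)) φ =
      Complex.I • lieDeriv (H := u21Group) ιA (liePMat (Pi.single i 1)) φ)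
    {M : ℝ} (hM : ∀ (q q' : Fin 2 × Fin 2) (g : 𝒢.Adelic),
      ‖lieDeriv (H := u21Group) ιA (liePMat (Pi.single q.1 (if q.2 = 0 then (1 : ℂ) else Complex.I)))
        (lieDeriv (H := u21Group) ιA (liePMat (Pi.single q'.1 (if q'.2 = 0 then (1 : ℂ) else Complex.I))) φ) g‖ ≤ M)
    (hmem : MemLp (toQuotFun 𝒢 φ) 2 μ) :
    DifferentiableAt ℝ (fun b : Fin 2 → ℂ => 𝒢.rightRegular μ (ιA (expP b)) (hmem.toLp (toQuotFun 𝒢 φ))) 0 ∧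
      ∀ b : Fin 2 → ℂ,
        fderiv ℝ (fun b : Fin 2 → ℂ => 𝒢.rightRegular μ (ιA (expP b)) (hmem.toLp (toQuotFun 𝒢 φ))) 0 (Complex.I • b) =
          Complex.I • fderiv ℝ (fun b : Fin 2 → ℂ => 𝒢.rightRegular μ (ιA (expP b)) (hmem.toLp (toQuotFun 𝒢 φ))) 0 b := by
  set B : (Fin 2 → ℂ) → 𝒢.L2 μ := fun b => 𝒢.rightRegular μ (ιA (expP b)) (hmem.toLp (toQuotFun 𝒢 φ)) with hB
  have hM0 : 0 ≤ M := (norm_nonneg _).trans (hM (0, 0) (0, 0) 1)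
  have hι1 : ιA (expP 0) = 1 := by
    rw [expP_zero]
    exact map_one ιA
  -- the classes of the four directional derivatives and the candidate derivative `D b = Σ_i b_i • [X_{e_i} φ]`
  have hmemD : ∀ i : Fin 2, MemLp (toQuotFun 𝒢 (lieDeriv (H := u21Group) ιA (liePMat (Pi.single i 1)) φ)) 2 μ :=
    fun i => memLp_toQuotFun (hD i).2 (hD i).1 2
  set v : Fin 2 → 𝒢.L2 μ := fun i =>
    (hmemD i).toLp (toQuotFun 𝒢 (lieDeriv (H := u21Group) ιA (liePMat (Pi.single i 1)) φ)) with hv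
  set D : (Fin 2 → ℂ) →L[ℂ] 𝒢.L2 μ :=
    ∑ i : Fin 2, (ContinuousLinearMap.proj i : (Fin 2 → ℂ) →L[ℂ] ℂ).smulRight (v i) with hDdef
  have hDapp : ∀ b : Fin 2 → ℂ, D b = ∑ i : Fin 2, b i • v i := fun b => by
    simp only [hDdef, _root_.sum_apply, ContinuousLinearMap.smulRight_apply, ContinuousLinearMap.proj_apply]
  -- translates
  have hmemT : ∀ a : 𝒢.Adelic, MemLp (toQuotFun 𝒢 fun x => φ (x * a)) 2 μ := fun a =>
    memLp_toQuotFun (leftInvariant_mul_right hΦ a) (hc.comp (continuous_id.mul continuous_const)) 2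
  have hBeq : ∀ b, B b = (hmemT (ιA (expP b))).toLp (toQuotFun 𝒢 fun x => φ (x * ιA (expP b))) := fun b =>
    (toLp_toQuotFun_mul_right hΦ _ hmem (hmemT _)).symm
  have hB' : ∀ b, (B b : 𝒢.automorphicQuotient → ℂ) =ᵐ[μ] toQuotFun 𝒢 fun x => φ (x * ιA (expP b)) := fun b => by
    rw [hBeq b]; exact (hmemT _).coeFn_toLp
  have hD' : ∀ b : Fin 2 → ℂ, (D b : 𝒢.automorphicQuotient → ℂ) =ᵐ[μ]
      toQuotFun 𝒢 fun x => ∑ i : Fin 2, b i * lieDeriv (H := u21Group) ιA (liePMat (Pi.single i 1)) φ x := fun b => by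
    rw [hDapp b]
    exact (F0P2dStubT.toQuotFun_sum_two_ae_eq (fun i => lieDeriv (H := u21Group) ιA (liePMat (Pi.single i 1)) φ) v
      (fun i => (hmemD i).coeFn_toLp.symm) b).symm
  -- the pointwise second-order bound
  have hpt : ∀ (b : Fin 2 → ℂ) (x : 𝒢.Adelic),
      ‖φ (x * ιA (expP b)) - φ x - ∑ i : Fin 2, b i * lieDeriv (H := u21Group) ιA (liePMat (Pi.single i 1)) φ x‖ ≤
        16 * M * ‖b‖ ^ 2 := by
    intro b x
    have hcrx : ∀ i : Fin 2, lieDeriv (H := u21Group) ιA (liePMat (Pi.single i Complex.I)) φ x =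
        Complex.I * lieDeriv (H := u21Group) ιA (liePMat (Pi.single i 1)) φ x := fun i => by
      have h := congrFun (hCR i) x
      simpa only [Pi.smul_apply, smul_eq_mul] using h
    have hsum : lieDeriv (H := u21Group) ιA (liePMat b) φ x =
        ∑ i : Fin 2, b i * lieDeriv (H := u21Group) ιA (liePMat (Pi.single i 1)) φ x := by
      rw [lieDeriv_liePMat_eq_sum ιA hsm b x]
      refine Finset.sum_congr rfl fun i _ => ?_
      rw [hcrx i]
      have e := Complex.re_add_im (b i)
      calc ((b i).re : ℂ) * lieDeriv (H := u21Group) ιA (liePMat (Pi.single i 1)) φ x +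
            (b i).im * (Complex.I * lieDeriv (H := u21Group) ιA (liePMat (Pi.single i 1)) φ x)
          = ((b i).re + (b i).im * Complex.I) * lieDeriv (H := u21Group) ιA (liePMat (Pi.single i 1)) φ x := by ring
        _ = b i * lieDeriv (H := u21Group) ιA (liePMat (Pi.single i 1)) φ x := by rw [e]
    rw [← hsum, ← expMem_liePMat]
    exact norm_sub_sub_lieDeriv_le ιA hsm (liePMat b) (isArchSmooth_lieDeriv_of_isArchSmooth ιA _ hsm)
      (fun g => norm_lieDeriv_lieDeriv_liePMat_le ιA hsm hM b g) x
  -- the `L²` bound on the remainder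
  have hK : ∀ b : Fin 2 → ℂ, ‖B b - B 0 - D b‖ ≤ (measureUnivNNReal μ : ℝ) ^ (2 : ℝ≥0∞).toReal⁻¹ * (16 * M * ‖b‖ ^ 2) := by
    intro b
    refine Lp.norm_le_of_ae_bound (by positivity) ?_
    filter_upwards [Lp.coeFn_sub (B b - B 0) (D b), Lp.coeFn_sub (B b) (B 0), hB' b, hB' 0, hD' b]
      with y h1 h2 h3 h4 h5
    rw [h1, Pi.sub_apply, h2, Pi.sub_apply, h3, h4, h5]
    simp only [toQuotFun]
    rw [hι1, mul_one]
    exact hpt b _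
  -- Fréchet differentiability at `0` with derivative `D`
  have hFD : HasFDerivAt B (D.restrictScalars ℝ) 0 := by
    rw [hasFDerivAt_iff_isLittleO_nhds_zero]
    have h1 : (fun h : Fin 2 → ℂ => B (0 + h) - B 0 - (D.restrictScalars ℝ) h) =O[𝓝 0] fun h => ‖h‖ ^ 2 := by
      refine IsBigO.of_bound ((measureUnivNNReal μ : ℝ) ^ (2 : ℝ≥0∞).toReal⁻¹ * (16 * M)) ?_
      refine Filter.Eventually.of_forall fun h => ?_
      rw [zero_add, ContinuousLinearMap.coe_restrictScalars', norm_pow, norm_norm]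
      have := hK h
      nlinarith [this]
    exact h1.trans_isLittleO (isLittleO_norm_pow_id one_lt_two)
  refine ⟨hFD.differentiableAt, fun b => ?_⟩
  rw [hFD.fderiv]
  simp only [ContinuousLinearMap.coe_restrictScalars', map_smul]

end L2Generic

end Summit.HodgeConjecture.HodgeConjecture.Cruxes.H413.F0P2dStubSOrbitMap

end
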